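import Summits.HodgeConjecture.CorCM.FixingCycleSlotPairs
import Summits.HodgeConjecture.CorCM.SharedSignCharacterQuadraticSubfield
import Summits.HodgeConjecture.CorCM.PairwiseCMFamiliesHodge
import Literature.NumberTheory.ComplexMultiplication.SharedImaginaryQuadraticFamilies
import Literature.AlgebraicGeometry.ComplexMultiplication.SimpleIffPrimitiveCMType
import Literature.AlgebraicGeometry.Pohlmann1968.NondegenerateCMTypeHodgeConjecture
import Literature.AlgebraicGeometry.Pohlmann1968.SeparatingCMFamilies
import Literature.AlgebraicGeometry.Pohlmann1968.SimpleCMAbelianVarietyPowersDivisorGenerated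
import HarnessLib

/-!
# A CM field of degree `2p` (`p` an odd prime) against ANY CM field of smaller degree: the pair of types is
# nondegenerate iff both are and the fields share no imaginary quadratic subfield — a simple CM abelian variety of
# PRIME dimension `p` times any CM abelian variety of dimension `< p`

COR-CM (cell `pub-hodgecm2`, binder seat `b16` gen 46, count-neutral claim PRIME-SLOT, file F3; theorems only, no
definition, no named fact, no `sorry`).  NEW as stated, hence under `Summits/`.  The tree decides pairs of CM slots by
seat p2's pairwise "no common constituent" criterion (`PairwiseCMFamiliesHodge`), fed so far by partial conjugations
(Galois closures meeting in totally real fields), by (□) on quartic slots and by foreign imaginary quadratic slots.  For a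
slot of PRIME half-degree these menus are not available in general (a non-Galois CM field of degree `2p` has a large
closure), but `CorCM/FixingCycleSlotPairs` + `CorCM/SharedSignCharacterQuadraticSubfield` give the exact answer:

* §1 **`pairwise_of_prime_of_not_exists_quadratic`** — `[K_a : ℚ] = 2p`, `p` an odd prime, `[K_b : ℚ] < 2p`, and NO
  imaginary quadratic subfield of `K_a` embeds in `K_b`: the slots `a`, `b` have no common constituent (both orders).
  (Cauchy in the image of `Aut(ℂ)` on `Hom(K_a, ℂ) ⊔ Hom(K_b, ℂ)` gives `c` of order `p` fixing `Hom(K_b, ℂ)` and cycling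
  the `p` pairs of `Hom(K_a, ℂ)`; a common constituent is then a shared sign character, i.e. a shared imaginary
  quadratic field.)
* §1 **`isNondegenerateFamily_iff_of_prime_gt`** — two slots `i₀` (degree `2p`) and `i₁` (degree `< 2p`), ANY types:
  `(Φ_{i₀}, Φ_{i₁})` is nondegenerate ⟺ both types are nondegenerate ∧ no imaginary quadratic `F ≤ K_{i₀}` embeds in
  `K_{i₁}` (⟹ by seat b23's `not_isNondegenerateFamily_of_shared_imaginary_quadratic`); with `Φ_{i₀}` PRIMITIVE the
  first conjunct is Yanai's theorem (`isNondegenerate_of_isPrimitive_of_prime`); `cmFamilyRank_add_two_eq_of_prime_gt`.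
* §2 on abelian varieties — `A_{i₀}` SIMPLE of prime dimension `p ≥ 3`, `A_{i₁}` of dimension `< p` (realisations of
  `(K_i; Φ_i)` on `H¹`): **`isNondegenerateFamily_iff_of_prime_dim`** (`Hg(A₀ × A₁) = Hg(A₀) × Hg(A₁)` ⟺ `Φ_{i₁}`
  nondegenerate ∧ no shared imaginary quadratic field), **`hodgeConjectureFor_prod_of_prime_dim`** (then the Hodge
  conjecture and `B• = D•` on EVERY `A₀^a × A₁^b`, UNCONDITIONALLY), and for `A_{i₁}` simple and non-isogenous to `A_{i₀}`
  the sharp forms `forall_prod_hodgeClassSpan_eq_iff_of_prime_dim`, `exists_exceptional_prod_iff_of_prime_dim`,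
  `hodgeConjectureFor_prod_or_exists_exceptional_of_prime_dim`.

Instances (`p = 3`: curves and surfaces against a simple CM threefold — the tree's Moonen–Zarhin cells, now uniform;
`p = 5`: a simple CM FIVEFOLD against every CM surface, threefold, fourfold; `p = 7`: a simple CM sevenfold against
everything of dimension `≤ 6`; …) and families of pairwise distinct prime dimensions are drawn in the sequel
`CorCM/DistinctPrimeDimensionsCMHodge`.  HONEST FRAMING: the Hodge conjecture for NAMED classes of CM abelian varieties;
`HC_CM` is neither used nor asserted.

## References

* [Gordon1999HodgeAVSurvey] B. B. Gordon, *A survey of the Hodge conjecture for abelian varieties*, §3 Theorem (Imai,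
  Murty), 6.3 Remark (Yanai), 7.4–7.7, 9.4, 10.10.
* [MoonenZarhin1999LowDim] B. Moonen, Yu. Zarhin, *Hodge classes on abelian varieties of low dimension*, Math. Ann. 315
  (1999), Thm. (0.2), Cor. (3.9).
* [Yanai1985] H. Yanai, *On the rank of CM-type*, Nagoya Math. J. 97 (1985), §3–§4.
-/

noncomputable section

open CategoryTheory CategoryTheory.Limits NumberField NumberField.ComplexEmbedding Module
open scoped BigOperators

namespace Summit.HodgeConjecture.CorCM

open Literature.NumberTheory.ComplexMultiplication
open Literature.AlgebraicGeometry.Motives (AbelianVariety CMType)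
open Literature.AlgebraicGeometry.HodgeTheory
open Literature.AlgebraicGeometry.ComplexMultiplication (IsCMTypeRealisation isSimple_iff_isPrimitive)
open Literature.AlgebraicGeometry.VanGeemen1994 (hodgeClassSpan)
open Literature.AlgebraicGeometry.Pohlmann1968
open Literature.Barriers.HodgeConjecture (divisorClassesSpan)

/-! ## §1 CM fields: a slot of prime half-degree against a smaller slot -/

section Fields

variable {I : Type} {K : I → Type} [∀ i, Field (K i)] [∀ i, NumberField (K i)] [∀ i, IsCMField (K i)]

/-- **No common constituent for a prime slot against a smaller slot without shared imaginary quadratic field** (both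
orders).  `[K_a : ℚ] = 2p` with `p` an odd prime, `[K_b : ℚ] < 2p`, and no `F ≤ K_a` with `[F : ℚ] = 2`, `F` totally
complex, `F ↪ K_b`: then no non-zero `Aut(ℂ)`-stable `P ≤ U(Φ_a)` maps equivariantly and injectively into `U(Φ_b)`, nor
vice versa. [cite: Gordon1999HodgeAVSurvey, §3 Theorem (proof) and 6.3 Remark] [cite: Yanai1985, §3] -/
theorem pairwise_of_prime_of_not_exists_quadratic (Φ : ∀ i, CMType (K i)) {a b : I} {p : ℕ} (hp : p.Prime)
    (hp2 : p ≠ 2) (ha : finrank ℚ (K a) = 2 * p) (hb : finrank ℚ (K b) < 2 * p)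
    (hno : ¬ ∃ F : IntermediateField ℚ (K a), finrank ℚ F = 2 ∧ IsTotallyComplex F ∧ Nonempty (F →+* K b)) :
    (∀ P : Submodule ℚ ((K a →+* ℂ) → ℚ), P ≤ antiSpan (ℂ ≃+* ℂ) (Φ a).1 →
      (∀ g : ℂ ≃+* ℂ, ∀ f ∈ P, (fun x => f (g • x)) ∈ P) →
      ∀ T : ((K a →+* ℂ) → ℚ) →ₗ[ℚ] ((K b →+* ℂ) → ℚ),
        (∀ g : ℂ ≃+* ℂ, ∀ f ∈ P, T (fun x => f (g • x)) = fun y => T f (g • y)) →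
        (∀ f ∈ P, T f ∈ antiSpan (ℂ ≃+* ℂ) (Φ b).1) → (∀ f ∈ P, T f = 0 → f = 0) → P = ⊥) ∧
    (∀ P : Submodule ℚ ((K b →+* ℂ) → ℚ), P ≤ antiSpan (ℂ ≃+* ℂ) (Φ b).1 →
      (∀ g : ℂ ≃+* ℂ, ∀ f ∈ P, (fun x => f (g • x)) ∈ P) →
      ∀ T : ((K b →+* ℂ) → ℚ) →ₗ[ℚ] ((K a →+* ℂ) → ℚ),
        (∀ g : ℂ ≃+* ℂ, ∀ f ∈ P, T (fun x => f (g • x)) = fun y => T f (g • y)) →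
        (∀ f ∈ P, T f ∈ antiSpan (ℂ ≃+* ℂ) (Φ a).1) → (∀ f ∈ P, T f = 0 → f = 0) → P = ⊥) := by
  classical
  have hCM : ∀ i, IsCMTypeWith (starRingAut : ℂ ≃+* ℂ) (Φ i).1 := fun i => isCMTypeWith_conj (Φ i)
  haveI : MulAction.IsPretransitive (ℂ ≃+* ℂ) (K a →+* ℂ) := isPretransitive_ringEquiv_complex
  have hca : Fintype.card (K a →+* ℂ) = 2 * p := by rw [Embeddings.card, ha]
  have hcb : Fintype.card (K b →+* ℂ) < 2 * p := by rw [Embeddings.card]; exact hb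
  obtain ⟨c, hc_b, hc_a⟩ := FixingCycle.exists_fixing_cycling_of_prime (G := ℂ ≃+* ℂ) (E := fun i => K i →+* ℂ)
    (Φ := fun i => (Φ i).1) hCM (a := a) (b := b) hp hp2 hca hcb
  refine FixingCycle.pairwise_of_fixing_cycling (G := ℂ ≃+* ℂ) (E := fun i => K i →+* ℂ) (Φ := fun i => (Φ i).1)
    hCM hc_b hc_a fun χ f f' hf hf' heig heig' hf0 hf'0 => hno ?_
  exact SignCharacter.exists_quadratic_subfield_ringHom_of_shared_eigen χ heig
    (fun x => apply_rho_smul_of_mem_antiSpan (hCM a) hf x) hf0 heig'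
    (fun y => apply_rho_smul_of_mem_antiSpan (hCM b) hf' y) hf'0

variable [Fintype I] [DecidableEq I]

/-- **Two slots, the prime one against a smaller one: nondegenerate iff both types are and no imaginary quadratic field
is shared.**  `[K_{i₀} : ℚ] = 2p` (`p` an odd prime), `[K_{i₁} : ℚ] < 2p`, any CM types: `(Φ_{i₀}, Φ_{i₁})` is
nondegenerate (`Hg(A₀ × A₁) = Hg(A₀) × Hg(A₁)` on realisations) iff `Φ_{i₀}`, `Φ_{i₁}` are nondegenerate and no imaginary
quadratic subfield of `K_{i₀}` embeds in `K_{i₁}`. [cite: Gordon1999HodgeAVSurvey, §3 Theorem and 7.5–7.7]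
[cite: MoonenZarhin1999LowDim, Thm. (0.2) (a)/(4)] -/
theorem isNondegenerateFamily_iff_of_prime_gt {i₀ i₁ : I} (h01 : i₀ ≠ i₁) (hI : ∀ j, j = i₀ ∨ j = i₁) {p : ℕ}
    (hp : p.Prime) (hp2 : p ≠ 2) (h0 : finrank ℚ (K i₀) = 2 * p) (h1 : finrank ℚ (K i₁) < 2 * p)
    (Φ : ∀ i, CMType (K i)) :
    CMAlgebra.IsNondegenerateFamily Φ ↔ (∀ i, IsNondegenerate (Φ i)) ∧
      ¬ ∃ F : IntermediateField ℚ (K i₀), finrank ℚ F = 2 ∧ IsTotallyComplex F ∧ Nonempty (F →+* K i₁) := by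
  haveI : Nonempty I := ⟨i₀⟩
  constructor
  · intro hnd
    refine ⟨fun i => hnd.isNondegenerate i, ?_⟩
    rintro ⟨F, hF2, hFtc, ⟨j₁⟩⟩
    haveI := hFtc
    exact not_isNondegenerateFamily_of_shared_imaginary_quadratic (k := ↥F) hF2 h01 (algebraMap (↥F) (K i₀)) j₁ Φ hnd
  · rintro ⟨hnd, hno⟩
    have hab := pairwise_of_prime_of_not_exists_quadratic Φ hp hp2 h0 h1 hno
    refine (isNondegenerateFamily_iff_forall_of_pairwise Φ fun i j hij => ?_).2 hnd
    rcases hI i with rfl | rfl <;> rcases hI j with rfl | rfl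
    · exact absurd rfl hij
    · exact hab.1
    · exact hab.2
    · exact absurd rfl hij

/-- **Rank additivity**: under the same hypotheses and no shared imaginary quadratic field,
`rank((Φ_{i₀}, Φ_{i₁})) + 2 = rank(Φ_{i₀}) + rank(Φ_{i₁}) + 1` — `rank Hg(A₀ × A₁) = rank Hg(A₀) + rank Hg(A₁)`, whatever
the types. [cite: Gordon1999HodgeAVSurvey, §3 Theorem (1)] -/
theorem cmFamilyRank_add_card_eq_of_prime_gt {i₀ i₁ : I} (h01 : i₀ ≠ i₁) (hI : ∀ j, j = i₀ ∨ j = i₁) {p : ℕ}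
    (hp : p.Prime) (hp2 : p ≠ 2) (h0 : finrank ℚ (K i₀) = 2 * p) (h1 : finrank ℚ (K i₁) < 2 * p)
    (Φ : ∀ i, CMType (K i))
    (hno : ¬ ∃ F : IntermediateField ℚ (K i₀), finrank ℚ F = 2 ∧ IsTotallyComplex F ∧ Nonempty (F →+* K i₁)) :
    CMAlgebra.cmFamilyRank Φ + Fintype.card I = (∑ i, cmTypeRank (Φ i)) + 1 := by
  haveI : Nonempty I := ⟨i₀⟩
  have hab := pairwise_of_prime_of_not_exists_quadratic Φ hp hp2 h0 h1 hno
  refine cmFamilyRank_add_card_eq_of_pairwise Φ fun i j hij => ?_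
  rcases hI i with rfl | rfl <;> rcases hI j with rfl | rfl
  · exact absurd rfl hij
  · exact hab.1
  · exact hab.2
  · exact absurd rfl hij

/-- **Primitive prime slot**: with `Φ_{i₀}` PRIMITIVE (Yanai: nondegenerate), the pair is nondegenerate iff `Φ_{i₁}` is
nondegenerate and no imaginary quadratic subfield of `K_{i₀}` embeds in `K_{i₁}`. [cite: Yanai1985, §4 Theorem (p. 171)]
[cite: Gordon1999HodgeAVSurvey, §3 Theorem and 6.3 Remark] -/
theorem isNondegenerateFamily_iff_of_prime_gt_of_isPrimitive {i₀ i₁ : I} (h01 : i₀ ≠ i₁) (hI : ∀ j, j = i₀ ∨ j = i₁)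
    {p : ℕ} (hp : p.Prime) (hp2 : p ≠ 2) (h0 : finrank ℚ (K i₀) = 2 * p) (h1 : finrank ℚ (K i₁) < 2 * p)
    (Φ : ∀ i, CMType (K i)) (φ₀ : K i₀ →+* ℂ) (hprim : IsPrimitive (ℂ ≃+* ℂ) (Φ i₀).1 φ₀) :
    CMAlgebra.IsNondegenerateFamily Φ ↔ IsNondegenerate (Φ i₁) ∧
      ¬ ∃ F : IntermediateField ℚ (K i₀), finrank ℚ F = 2 ∧ IsTotallyComplex F ∧ Nonempty (F →+* K i₁) := by
  rw [isNondegenerateFamily_iff_of_prime_gt h01 hI hp hp2 h0 h1 Φ]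
  have hnd₀ : IsNondegenerate (Φ i₀) := isNondegenerate_of_isPrimitive_of_prime hp h0 φ₀ hprim
  refine ⟨fun H => ⟨H.1 i₁, H.2⟩, fun H => ⟨fun i => ?_, H.2⟩⟩
  rcases hI i with rfl | rfl
  · exact hnd₀
  · exact H.1

end Fields

/-! ## §2 Abelian varieties: a simple CM abelian variety of prime dimension against a smaller one -/

section Geometry

variable {I : Type} {K : I → Type} [∀ i, Field (K i)] [∀ i, NumberField (K i)] [∀ i, IsCMField (K i)] [Fintype I]
  [DecidableEq I] {Φ : ∀ i, CMType (K i)}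
variable {A : I → AbelianVariety ℂ} {ι : ∀ i, 𝓞 (K i) →+* End (A i)}
  {θ : ∀ i, K i →+* Module.End ℂ (complexBetti (A i).X 1)}

/-- **`Hg(A₀ × A₁) = Hg(A₀) × Hg(A₁)` iff …** — `A_{i₀}` a SIMPLE CM abelian variety of PRIME dimension `p ≥ 3`, `A_{i₁}`
any realisation of `(K_{i₁}; Φ_{i₁})` of dimension `< p`: the pair of types is nondegenerate iff `Φ_{i₁}` is nondegenerate
and no imaginary quadratic subfield of `K_{i₀} = End⁰(A_{i₀})` embeds in `K_{i₁}`.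
[cite: MoonenZarhin1999LowDim, Thm. (0.2)] [cite: Gordon1999HodgeAVSurvey, §3 Theorem, 6.3 Remark and 7.5–7.7] -/
theorem isNondegenerateFamily_iff_of_prime_dim {i₀ i₁ : I} (h01 : i₀ ≠ i₁) (hI : ∀ j, j = i₀ ∨ j = i₁) {p : ℕ}
    (hp : p.Prime) (hp2 : p ≠ 2) (hA : ∀ i, IsCMTypeRealisation (Φ i) (A i) (ι i) (θ i)) (hd₀ : (A i₀).dim = p)
    (hd₁ : (A i₁).dim < p) (hS₀ : (A i₀).IsSimple) :
    CMAlgebra.IsNondegenerateFamily Φ ↔ IsNondegenerate (Φ i₁) ∧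
      ¬ ∃ F : IntermediateField ℚ (K i₀), finrank ℚ F = 2 ∧ IsTotallyComplex F ∧ Nonempty (F →+* K i₁) := by
  obtain ⟨φ₀⟩ : Nonempty (K i₀ →+* ℂ) := inferInstance
  have h0 : finrank ℚ (K i₀) = 2 * p := by rw [finrank_eq_two_mul_dim_of_isCMTypeRealisation (hA i₀), hd₀]
  have h1 : finrank ℚ (K i₁) < 2 * p := by rw [finrank_eq_two_mul_dim_of_isCMTypeRealisation (hA i₁)]; omega
  exact isNondegenerateFamily_iff_of_prime_gt_of_isPrimitive h01 hI hp hp2 h0 h1 Φ φ₀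
    ((isSimple_iff_isPrimitive (hA i₀) φ₀).1 hS₀)

/-- **The Hodge conjecture on every `A₀^a × A₁^b`** — `A_{i₀}` SIMPLE of prime dimension `p ≥ 3`, `A_{i₁}` a realisation of
a NONDEGENERATE type of dimension `< p` whose CM field receives no imaginary quadratic subfield of `End⁰(A_{i₀})`: the
Hodge conjecture and `B• = D•` on every `⨁_{j<N} A_{π j}`, UNCONDITIONALLY. [cite: Gordon1999HodgeAVSurvey, §3 Theorem and 10.10]
[cite: MoonenZarhin1999LowDim, Thm. (0.2) (4)] -/
theorem hodgeConjectureFor_prod_of_prime_dim {i₀ i₁ : I} (h01 : i₀ ≠ i₁) (hI : ∀ j, j = i₀ ∨ j = i₁) {p : ℕ}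
    (hp : p.Prime) (hp2 : p ≠ 2) (hA : ∀ i, IsCMTypeRealisation (Φ i) (A i) (ι i) (θ i)) (hd₀ : (A i₀).dim = p)
    (hd₁ : (A i₁).dim < p) (hS₀ : (A i₀).IsSimple) (hnd₁ : IsNondegenerate (Φ i₁))
    (hno : ¬ ∃ F : IntermediateField ℚ (K i₀), finrank ℚ F = 2 ∧ IsTotallyComplex F ∧ Nonempty (F →+* K i₁))
    {N : ℕ} (π : Fin N → I) :
    HodgeConjectureFor (⨁ fun j : Fin N => A (π j)).dim (⨁ fun j : Fin N => A (π j)).X ∧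
      ∀ m : ℕ, hodgeClassSpan (⨁ fun j : Fin N => A (π j)).dim (⨁ fun j : Fin N => A (π j)).X m =
        divisorClassesSpan (⨁ fun j : Fin N => A (π j)).X (⨁ fun j : Fin N => A (π j)).dim m := by
  haveI : Nonempty I := ⟨i₀⟩
  have h := (isNondegenerateFamily_iff_of_prime_dim h01 hI hp hp2 hA hd₀ hd₁ hS₀).2 ⟨hnd₁, hno⟩
  exact ⟨h.hodgeConjectureFor_prod hA π, fun m => h.hodgeClassSpan_prod_eq_divisorClassesSpan hA π m⟩

/-- **`B• = D•` on EVERY `A₀^a × A₁^b` iff …** (separating form: `A_{i₀}` simple of prime dimension `p ≥ 3`, `A_{i₁}` SIMPLE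
of dimension `< p`, the two NOT isogenous — automatic for different dimensions, kept as the tree's separating
hypothesis): iff `Φ_{i₁}` is nondegenerate and no imaginary quadratic subfield of `K_{i₀}` embeds in `K_{i₁}`.
[cite: Gordon1999HodgeAVSurvey, 7.5–7.7 and 9.4] -/
theorem forall_prod_hodgeClassSpan_eq_iff_of_prime_dim {i₀ i₁ : I} (h01 : i₀ ≠ i₁) (hI : ∀ j, j = i₀ ∨ j = i₁)
    {p : ℕ} (hp : p.Prime) (hp2 : p ≠ 2) (hA : ∀ i, IsCMTypeRealisation (Φ i) (A i) (ι i) (θ i))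
    (hd₀ : (A i₀).dim = p) (hd₁ : (A i₁).dim < p) (hS : ∀ i, (A i).IsSimple)
    (hniso : ∀ i j, i ≠ j → ¬ AbelianVariety.IsIsogenous (A i) (A j)) :
    (∀ (N : ℕ) (π : Fin N → I) (m : ℕ),
        hodgeClassSpan (⨁ fun j : Fin N => A (π j)).dim (⨁ fun j : Fin N => A (π j)).X m =
          divisorClassesSpan (⨁ fun j : Fin N => A (π j)).X (⨁ fun j : Fin N => A (π j)).dim m) ↔
      IsNondegenerate (Φ i₁) ∧
        ¬ ∃ F : IntermediateField ℚ (K i₀), finrank ℚ F = 2 ∧ IsTotallyComplex F ∧ Nonempty (F →+* K i₁) := by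
  haveI : Nonempty I := ⟨i₀⟩
  exact (CMAlgebra.isNondegenerateFamily_iff_forall_prod_hodgeClassSpan_eq
      (CMAlgebra.isSeparatingFamily_of_isSimple_of_pairwise_not_isIsogenous hA hS hniso) hA).symm.trans
    (isNondegenerateFamily_iff_of_prime_dim h01 hI hp hp2 hA hd₀ hd₁ (hS i₀))

/-- **An exceptional Hodge class on some `A₀^a × A₁^b` iff `Φ_{i₁}` is degenerate or the fields SHARE an imaginary
quadratic subfield** (same separating setting; the classes are not claimed algebraic or non-algebraic here).
[cite: Gordon1999HodgeAVSurvey, 7.5–7.7 and 9.4] -/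
theorem exists_exceptional_prod_iff_of_prime_dim {i₀ i₁ : I} (h01 : i₀ ≠ i₁) (hI : ∀ j, j = i₀ ∨ j = i₁)
    {p : ℕ} (hp : p.Prime) (hp2 : p ≠ 2) (hA : ∀ i, IsCMTypeRealisation (Φ i) (A i) (ι i) (θ i))
    (hd₀ : (A i₀).dim = p) (hd₁ : (A i₁).dim < p) (hS : ∀ i, (A i).IsSimple)
    (hniso : ∀ i j, i ≠ j → ¬ AbelianVariety.IsIsogenous (A i) (A j)) :
    (∃ (N : ℕ) (π : Fin N → I) (m : ℕ) (c : complexBetti (⨁ fun j : Fin N => A (π j)).X (2 * m)),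
        IsRationalClass c ∧
        IsOfHodgeType (⨁ fun j : Fin N => A (π j)).dim (⨁ fun j : Fin N => A (π j)).X (2 * m) m m c ∧
        c ∉ divisorClassesSpan (⨁ fun j : Fin N => A (π j)).X (⨁ fun j : Fin N => A (π j)).dim m) ↔
      ¬ IsNondegenerate (Φ i₁) ∨
        ∃ F : IntermediateField ℚ (K i₀), finrank ℚ F = 2 ∧ IsTotallyComplex F ∧ Nonempty (F →+* K i₁) := by
  haveI : Nonempty I := ⟨i₀⟩
  have hsep := CMAlgebra.isSeparatingFamily_of_isSimple_of_pairwise_not_isIsogenous hA hS hniso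
  have key := isNondegenerateFamily_iff_of_prime_dim h01 hI hp hp2 hA hd₀ hd₁ (hS i₀)
  constructor
  · rintro ⟨N, π, m, c, hc, hpq, hnot⟩
    by_contra hno
    obtain ⟨h1, h2⟩ := not_or.1 hno
    exact (key.2 ⟨not_not.1 h1, h2⟩).not_exists_exceptional_prod hA π m ⟨c, hc, hpq, hnot⟩
  · intro hor
    refine CMAlgebra.exists_exceptional_prod_of_not_isNondegenerateFamily hsep (fun hnd => ?_) hA
    rcases hor with h | h
    · exact h (key.1 hnd).1
    · exact (key.1 hnd).2 h

/-- **The dichotomy, packaged**: for `A_{i₀}` simple of prime dimension `p ≥ 3` and `A_{i₁}` simple of dimension `< p`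
with a NONDEGENERATE type (e.g. simple of dimension `≤ 3` or of prime dimension), EITHER the CM fields share no imaginary
quadratic subfield and the Hodge conjecture (with `B• = D•`) holds on every `A₀^a × A₁^b`, OR they share one and some
`A₀^a × A₁^b` carries an exceptional Hodge class. [cite: Gordon1999HodgeAVSurvey, 7.5–7.7 and 10.10] -/
theorem hodgeConjectureFor_prod_or_exists_exceptional_of_prime_dim {i₀ i₁ : I} (h01 : i₀ ≠ i₁)
    (hI : ∀ j, j = i₀ ∨ j = i₁) {p : ℕ} (hp : p.Prime) (hp2 : p ≠ 2)
    (hA : ∀ i, IsCMTypeRealisation (Φ i) (A i) (ι i) (θ i)) (hd₀ : (A i₀).dim = p) (hd₁ : (A i₁).dim < p)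
    (hS : ∀ i, (A i).IsSimple) (hniso : ∀ i j, i ≠ j → ¬ AbelianVariety.IsIsogenous (A i) (A j))
    (hnd₁ : IsNondegenerate (Φ i₁)) :
    ((¬ ∃ F : IntermediateField ℚ (K i₀), finrank ℚ F = 2 ∧ IsTotallyComplex F ∧ Nonempty (F →+* K i₁)) ∧
        ∀ (N : ℕ) (π : Fin N → I),
          HodgeConjectureFor (⨁ fun j : Fin N => A (π j)).dim (⨁ fun j : Fin N => A (π j)).X ∧
            ∀ m : ℕ, hodgeClassSpan (⨁ fun j : Fin N => A (π j)).dim (⨁ fun j : Fin N => A (π j)).X m =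
              divisorClassesSpan (⨁ fun j : Fin N => A (π j)).X (⨁ fun j : Fin N => A (π j)).dim m) ∨
      ((∃ F : IntermediateField ℚ (K i₀), finrank ℚ F = 2 ∧ IsTotallyComplex F ∧ Nonempty (F →+* K i₁)) ∧
        ∃ (N : ℕ) (π : Fin N → I) (m : ℕ) (c : complexBetti (⨁ fun j : Fin N => A (π j)).X (2 * m)),
          IsRationalClass c ∧
          IsOfHodgeType (⨁ fun j : Fin N => A (π j)).dim (⨁ fun j : Fin N => A (π j)).X (2 * m) m m c ∧
          c ∉ divisorClassesSpan (⨁ fun j : Fin N => A (π j)).X (⨁ fun j : Fin N => A (π j)).dim m) := by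
  by_cases hF : ∃ F : IntermediateField ℚ (K i₀), finrank ℚ F = 2 ∧ IsTotallyComplex F ∧ Nonempty (F →+* K i₁)
  · exact Or.inr ⟨hF, (exists_exceptional_prod_iff_of_prime_dim h01 hI hp hp2 hA hd₀ hd₁ hS hniso).2 (Or.inr hF)⟩
  · exact Or.inl ⟨hF, fun N π => hodgeConjectureFor_prod_of_prime_dim h01 hI hp hp2 hA hd₀ hd₁ (hS i₀) hnd₁ hF π⟩

end Geometry

end Summit.HodgeConjecture.CorCM

end
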